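import Literature.NumberTheory.Sieve.GoldbachLinnikLevelOfDistribution
import Literature.NumberTheory.Sieve.ElliottHalberstamBridgeProofs
import HarnessLib

/-!
# The twin-prime sieve constant from a level of distribution: `TwinSieveUpperBound (2/ϑ)`;
the constant `2` under Elliott–Halberstam

Topic `Literature/NumberTheory/Sieve`; third proofs file of `HardyLittlewood.lean` (parity.S31), companion of
`HardyLittlewoodTwinSieveProofs` (`TwinSieveFour.twinSieveUpperBound_four : TwinSieveUpperBound 4`, PROVED from
the linear sieve at the Bombieri–Vinogradov level) and of `GoldbachLinnikLevelOfDistribution` §1–§3 (a level `ϑ`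
of the primes gives the PAIR-count constant `2/ϑ` times Hardy–Littlewood, uniformly in the shift:
`PrimePairSieve.primePairs_card_le_of_level`, `GoldbachLinnik.pairSieveBound_of_level`,
`GoldbachLinnik.pairSieveBound_one_two_of_EH`).  This file records the `h = 2` instance in the currency of
parity.S31, `Literature.NumberTheory.Sieve.TwinSieveUpperBound C` (`π₂(x) ≤ (C + o(1)) · 2C₂ x/(log x)²`),
which is the form the parity/twin-prime files of the tree consume:

* `TwinSieveLevel.twinSieveUpperBound_of_level : PrimesHaveLevel ϑ → 0 < ϑ → TwinSieveUpperBound (2/ϑ)`;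
* `TwinSieveLevel.twinSieveUpperBound_of_level_lt : 0 < ϑ₀ → (∀ ϑ < ϑ₀, PrimesHaveLevel ϑ) →
  TwinSieveUpperBound (2/ϑ₀)` — the hypothesis shape of Bombieri–Vinogradov (`ϑ₀ = 1/2`,
  `BombieriVinogradovStatement`) and of Elliott–Halberstam (`ϑ₀ = 1`, `LevelOfDistribution.ElliottHalberstam`);
* `TwinSieveLevel.twinSieveUpperBound_two_of_EH : LevelOfDistribution.ElliottHalberstam → TwinSieveUpperBound 2`
  and the Wave0 form `twinSieveUpperBound_two_of_elliottHalberstamConjecture` (parity.S25's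
  `ElliottHalberstamConjecture`);
* consistency: Bombieri–Vinogradov (`BombieriVinogradovStatement_holds`, a THEOREM of the tree) re-derives
  `TwinSieveUpperBound 4` through `twinSieveUpperBound_of_level_lt` (an `example`; the statement is the tree's
  `TwinSieveFour.twinSieveUpperBound_four`, there with the sieving range `z = x^{1/4}`, here with `z = x^{ϑ₁/3}`).

Everything is PROVED from results proved in the tree (Iwaniec's linear sieve upper bound, Mertens, PNT, the
`ψ → π` transfer `PrimesHaveLevel.primesHaveLevelPi`); no named fact is introduced.  The two hypotheses
`PrimesHaveLevel ϑ` (`ϑ > 1/2`) and `ElliottHalberstam` are OPEN conjectures and appear only as hypotheses;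
nothing about them is asserted.

Source check.  Lichtman, *A modification of the linear sieve, and the count of twin primes*, Algebra & Number
Theory 19 (2025) 1–38 = arXiv:2109.02851, §1.1, the paragraph after the chronology table (arXiv p. 4):
"Bombieri–Davenport obtained `π₂(x)/Π(x) ≲ 4` as a consequence of the Bombieri–Vinogradov theorem (eq:BV) and a
standard sieve upper bound of level `x^{1/2−ε}`.  More generally, if one proves level of distribution `x^{θ−ε}`
then one immediately obtains `π₂(x)/Π(x) ≲ 2/θ`."  Here `Π(x) = 2C₂x/(log x)²` (§1.1, the display defining `Π`)
and `f ≲ g` means `f ≤ (1 + o(1))g` (Notation), so "`π₂(x)/Π(x) ≲ 2/θ`" is exactly `TwinSieveUpperBound (2/θ)`, and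
"level of distribution `x^{θ−ε}`" (for every `ε > 0`, with absolute values and the maximum over residues, (eq:BV))
is the tree's `PrimesHaveLevel θ` (whose definition carries the `ε`), equivalently `∀ ϑ < θ, PrimesHaveLevel ϑ`
(`twinSieveUpperBound_of_level_lt`).  The value at `θ = 1` — the constant `2`, twice the Hardy–Littlewood
prediction — is the parity constant of upper-bound sieves (Selberg; Bombieri's asymptotic sieve,
`Literature.NumberTheory.Sieve.bombieri_asymptotic_sieve`: the prime mass is determined only up to `δ ∈ [0, 2]`);
Johnston–Trudgian, arXiv:2605.17825, Prop. EHprop, record the same halving for the pair count ("the exact same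
proof gives `C₁ = 4`", their `C₁ = 2·C` of this file), formalised for pairs as `GoldbachLinnik.pairSieveBound_one_two_of_EH`.

## References

* E. Bombieri, H. Davenport, *Small differences between prime numbers*, Proc. Roy. Soc. A 293 (1966) 1–18.
  [BombieriDavenport1966]
* J. D. Lichtman, *A modification of the linear sieve, and the count of twin primes*, Algebra Number Theory 19
  (2025), no. 1, 1–38; arXiv:2109.02851, §1.1 (chronology and the `2/θ` remark, arXiv p. 4). [Lichtman2025LinearSieve]
* D. R. Johnston, T. Trudgian, *An update on the Linnik–Goldbach and Romanov problems*, arXiv:2605.17825v2 (2026),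
  §2.1 and Proposition EHprop. PREPRINT. [JohnstonTrudgian2026]
* P. D. T. A. Elliott, H. Halberstam, *A conjecture in prime number theory*, Symposia Mathematica IV (INDAM, Rome,
  1968/69), Academic Press 1970, 59–72. [ElliottHalberstam1970]
* H. Iwaniec, *Rosser's sieve*, Acta Arith. 36 (1980) 171–202, Theorem 1. [IwaniecActaArith1980]
-/

open Finset Filter Topology

noncomputable section

namespace Literature.NumberTheory.Sieve

namespace TwinSieveLevel

/-! ### The dictionary `h = 2`: pair count = `π₂`, `Chen.singularSeries 2 = C₂` -/

/-- `Chen.singularSeries 2 = C₂` (the local factor over the odd prime divisors of `2` is empty).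
[cite: Nathanson1996, (10.2)] -/
theorem singularSeries_two : Chen.singularSeries 2 = twinPrimeConst := by
  rw [Chen.singularSeries, Nat.Prime.primeFactors Nat.prime_two, Finset.filter_singleton,
    if_neg (lt_irrefl 2), Finset.prod_empty, mul_one]

/-- `#{p ≤ x prime : p + 2 prime} = π₂(x)` (`Literature.NumberTheory.Sieve.twinPrimeCount`; private plumbing,
the two finsets are the same filter of `range (x + 1)`). [folklore] -/
private theorem card_primesLE_filter_add_two (x : ℕ) :
    ((Nat.primesLE x).filter fun p => (p + 2).Prime).card = twinPrimeCount x := by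
  rw [twinPrimeCount, Nat.primesLE_eq_filter_range, Finset.filter_filter]

/-! ### A level of distribution `ϑ` gives `TwinSieveUpperBound (2/ϑ)` -/

/-- **The twin-prime sieve constant from a level of distribution** (Lichtman 2025, §1.1: "if one proves
level of distribution `x^{θ−ε}` then one immediately obtains `π₂(x)/Π(x) ≲ 2/θ`"): if the primes have level
`x^ϑ` in the Bombieri–Vinogradov sense (`PrimesHaveLevel ϑ`, `0 < ϑ`; a THEOREM for `ϑ ≤ 1/2`, OPEN beyond),
then `π₂(x) ≤ (2/ϑ + o(1)) · 2C₂ x/(log x)²`, i.e. `TwinSieveUpperBound (2/ϑ)` — the case `h = 2` of the tree's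
`PrimePairSieve.primePairs_card_le_of_level` (Iwaniec's linear sieve upper bound with `z = x^{ϑ₁/3}`,
`y = x^{ϑ₁}`, `F(3) = 2e^γ/3`, remainder by the level in `π`-form, Mertens).
[cite: Lichtman2025LinearSieve, §1.1 (the paragraph after the chronology table; arXiv 2109.02851 p. 4)]
[cite: IwaniecActaArith1980, Thm 1 (1.4)] -/
theorem twinSieveUpperBound_of_level {θ : ℝ} (hL : PrimesHaveLevel θ) (hθ : 0 < θ) :
    TwinSieveUpperBound (2 / θ) := by
  intro ε hε
  filter_upwards [PrimePairSieve.primePairs_card_le_of_level hL hθ ε hε] with x hx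
  have h := hx 2 even_two two_ne_zero
  rw [card_primesLE_filter_add_two, singularSeries_two] at h
  exact h

/-- **Level `x^ϑ` for every `ϑ < ϑ₀` already gives the constant `2/ϑ₀`** (the `ε` of `TwinSieveUpperBound`
absorbs the loss: `ϑ := 4ϑ₀/(4 + εϑ₀) < ϑ₀` has `2/ϑ = 2/ϑ₀ + ε/2`).  This is the hypothesis shape of
Bombieri–Vinogradov (`ϑ₀ = 1/2`: `BombieriVinogradovStatement`, giving Bombieri–Davenport's `4`, the tree's
`TwinSieveFour.twinSieveUpperBound_four`) and of Elliott–Halberstam (`ϑ₀ = 1`: constant `2`,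
`twinSieveUpperBound_two_of_EH`). [cite: Lichtman2025LinearSieve, §1.1 (chronology: 1966 Bombieri–Davenport 4; the 2/θ remark)] -/
theorem twinSieveUpperBound_of_level_lt {θ₀ : ℝ} (hθ₀ : 0 < θ₀) (h : ∀ θ : ℝ, θ < θ₀ → PrimesHaveLevel θ) :
    TwinSieveUpperBound (2 / θ₀) := by
  intro η hη
  have hden : 0 < 4 + η * θ₀ := by positivity
  have hθ0 : 0 < 4 * θ₀ / (4 + η * θ₀) := by positivity
  have hθlt : 4 * θ₀ / (4 + η * θ₀) < θ₀ := by
    rw [div_lt_iff₀ hden]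
    nlinarith [mul_pos hη (mul_pos hθ₀ hθ₀)]
  have h2 : 2 / (4 * θ₀ / (4 + η * θ₀)) + η / 2 = 2 / θ₀ + η := by
    field_simp
    ring
  have hB := twinSieveUpperBound_of_level (h _ hθlt) hθ0 (η / 2) (by linarith)
  rw [h2] at hB
  exact hB

-- Consistency check (an `example`, since the statement is the tree's `TwinSieveFour.twinSieveUpperBound_four`):
-- the Bombieri–Vinogradov theorem (`BombieriVinogradovStatement_holds`, level `ϑ` for every `ϑ < 1/2`, a THEOREM
-- of the tree) re-derives Bombieri–Davenport's constant `4` through `twinSieveUpperBound_of_level_lt`.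
example : TwinSieveUpperBound 4 := by
  have h := twinSieveUpperBound_of_level_lt (θ₀ := 1 / 2) (by norm_num) BombieriVinogradovStatement_holds
  norm_num at h
  exact h

/-! ### Elliott–Halberstam gives the parity constant `2` -/

/-- **Under the Elliott–Halberstam conjecture the twin-prime sieve constant is `2`**:
`LevelOfDistribution.ElliottHalberstam → TwinSieveUpperBound 2`, i.e. EH `⟹ π₂(x) ≤ (2 + o(1)) · 2C₂ x/(log x)²`
— twice the Hardy–Littlewood prediction, the parity constant of upper-bound sieves (Lichtman §1.1 with `θ = 1`;
Johnston–Trudgian Prop. EHprop for pairs).  PROVED here from the tree's linear sieve; EH itself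
(`LevelOfDistribution.ElliottHalberstam`, a `def … : Prop`) is OPEN and only a hypothesis.
[cite: Lichtman2025LinearSieve, §1.1 (the 2/θ remark, θ = 1)] [cite: JohnstonTrudgian2026, Proposition EHprop] -/
theorem twinSieveUpperBound_two_of_EH (hEH : LevelOfDistribution.ElliottHalberstam) : TwinSieveUpperBound 2 := by
  have h := twinSieveUpperBound_of_level_lt one_pos hEH
  norm_num at h
  exact h

/-- The same from the Wave0 form of the conjecture (parity.S25, `ElliottHalberstamConjecture = ∀ θ < 1, EH θ`,
equivalent to `LevelOfDistribution.ElliottHalberstam` by `elliottHalberstam_of_wave0`).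
[cite: ElliottHalberstam1970, Conjecture (= Polymath 8b Claim 2.2)] -/
theorem twinSieveUpperBound_two_of_elliottHalberstamConjecture (h : ElliottHalberstamConjecture) :
    TwinSieveUpperBound 2 :=
  twinSieveUpperBound_two_of_EH (elliottHalberstam_of_wave0 h)

end TwinSieveLevel

end Literature.NumberTheory.Sieve
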